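import Mathlib
import HarnessLib
import Literature.MathematicalPhysics.QuantumFieldTheory.GaussianLogDensitySecondOrder
import Literature.MathematicalPhysics.QuantumFieldTheory.GaussianCovarianceComparisonTraceVector
import Literature.Analysis.UnboundedOperators.DiagonalSemigroupCalculus

/-!
# `|E_{N(0,S₁)}H + E_{N(0,S₂)}H − 2E_{N(0,S₀)}H| ≤ (100q²h² + 4qk)·‖H‖_{L^p(N(0,S₀))}` — the DIMENSION-FREE
# SECOND-ORDER comparison of centred Gaussians ([Buc16] Thm 4.5 / [ABKM19] Thm 6.2, Lemma 8.4 with `ℓ = 2`)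

`GaussianCovarianceComparisonTrace(Vector)` is the `ℓ = 1` estimate: two centred Gaussians whose covariances
are Hilbert–Schmidt close (`tr((1 − S₀S₁⁻¹)²) ≤ h²`) have expectations of `L^p` functionals within `8qh‖H‖_p`.
The renormalisation-group `C^{1,1}`-dependence of the step operators on the tuning parameter
([ABKM19] Lemma 8.4 / Lemma 12.6 with `ℓ = 2`) needs the SECOND difference along a line of covariances.
Here is the finite-dimensional core, with no commutativity assumption: for `S₀, S₁, S₂ ≻ 0`,
`B_i = S₀⁻¹ − S_i⁻¹`, `tr((S₀B_i)²) ≤ h²` (`0 ≤ h ≤ 1/(4q)`) and `tr((S₀(B₁ + B₂))²) ≤ k²` (`k ≥ 0` — the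
genuinely second-order datum: at the midpoint `S₀ = ½(S₁ + S₂)` of a covariance segment `k = O(h²)`),

* `abs_integral_gaussRatio_sub_sub_linear_le` — ONE comparison covariance to second order:
  `|E_{S₁}H − E_{S₀}H − (c·E_{S₀}H + ½E_{S₀}[Q H])| ≤ 48q²h²‖H‖_p` where `dN(0,S₁)/dN(0,S₀) = e^{c + ½Q}`
  (`|c| ≤ h²`, `Q` the centred chaos of `B₁`): `|e^Z − 1 − Z| ≤ Z²e^{|Z|}` and the `L^q` size `O(q²h²)` of
  `Z²e^{|Z|}` (`GaussianLogDensitySecondOrder`);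
* **`abs_integral_multivariateGaussian_secondDiff_le_of_trace`** (real `H`) and
  **`norm_integral_multivariateGaussian_secondDiff_le_of_trace`** (Banach-valued `H`, by duality):
  `‖E_{S₁}H + E_{S₂}H − 2E_{S₀}H‖ ≤ (100 q²h² + 4 q k) (∫‖H‖^p dN(0,S₀))^{1/p}` — the two linear terms
  `Z₁ + Z₂ = (c₁ + c₂) + ½(Q₁ + Q₂)` recombine into the constants (`≤ 2h²`) and the centred chaos of
  `B₁ + B₂` (`‖·‖_{L^q} ≤ 8qk`, Whittle).

No dependence on `|ι|`.  The smallness `h ≤ 1/(4q)` is removed downstream by subdividing the covariance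
segment (`SecondDifferenceSubdivision`), each local second difference being taken at the exact midpoint.
Everything is proved; no named fact; finite-dimensional Gaussian calculus only.

## References
* S. Buchholz, *Finite range decomposition for Gaussian measures with improved regularity*,
  J. Funct. Anal. 275 (2018), Thm 4.5 (`ℓ`-th derivative form), Lemma 4.6 [Buchholz2016].
* S. Adams, S. Buchholz, R. Kotecký, S. Müller, arXiv:1910.13564, Theorem 6.2, Lemma 8.4 (`ℓ = 2`)
  [AdamsBuchholzKoteckyMuller2019].
-/

noncomputable section

namespace Literature.MathematicalPhysics.QuantumFieldTheory

open MeasureTheory ProbabilityTheory Matrix WithLp GaussianToolkit Unitary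
open scoped ENNReal NNReal MatrixOrder BigOperators

variable {ι : Type*} [Fintype ι] [DecidableEq ι]

/-! ## One comparison covariance, to second order -/

/-- **Second-order expansion of one density ratio against an `L^p` functional.**  For `S₀, S₁ ≻ 0` with
`tr((S₀(S₀⁻¹ − S₁⁻¹))²) ≤ h²`, `0 < h ≤ 1/(4q)`, `p, q` Hölder conjugate and `H ∈ L^p(N(0,S₀))`, writing
`dN(0,S₁)/dN(0,S₀) = e^{c + ½Q}` (`|c| ≤ h²`, `Q(y) = yᵀBy − tr(√S₀B√S₀)`, `B = S₀⁻¹ − S₁⁻¹`):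
`Q·H` is integrable and `|E_{S₁}H − E_{S₀}H − (c·E_{S₀}H + ½E_{S₀}[QH])| ≤ 48 q² h² ‖H‖_{L^p(N(0,S₀))}`.
[cite: Buchholz2016, Thm 4.5] -/
theorem abs_integral_gaussRatio_sub_sub_linear_le {S₀ S₁ : Matrix ι ι ℝ} (hS₀ : S₀.PosDef)
    (hS₁ : S₁.PosDef) {h : ℝ} (hh : 0 < h)
    (htr : ((S₀ * (S₀⁻¹ - S₁⁻¹)) * (S₀ * (S₀⁻¹ - S₁⁻¹))).trace ≤ h ^ 2)
    {p q : ℝ} (hpq : p.HolderConjugate q) (hhq : h ≤ 1 / (4 * q))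
    {H : EuclideanSpace ℝ ι → ℝ} (hH : MemLp H (ENNReal.ofReal p) (multivariateGaussian 0 S₀)) :
    ∃ c : ℝ, |c| ≤ h ^ 2 ∧
      Integrable (fun y => (ofLp y ⬝ᵥ (S₀⁻¹ - S₁⁻¹) *ᵥ ofLp y -
          (CFC.sqrt S₀ * (S₀⁻¹ - S₁⁻¹) * CFC.sqrt S₀).trace) * H y) (multivariateGaussian 0 S₀) ∧
      |∫ y, H y ∂(multivariateGaussian 0 S₁) - ∫ y, H y ∂(multivariateGaussian 0 S₀) -
          (c * ∫ y, H y ∂(multivariateGaussian 0 S₀) +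
            1 / 2 * ∫ y, (ofLp y ⬝ᵥ (S₀⁻¹ - S₁⁻¹) *ᵥ ofLp y -
              (CFC.sqrt S₀ * (S₀⁻¹ - S₁⁻¹) * CFC.sqrt S₀).trace) * H y ∂(multivariateGaussian 0 S₀))| ≤
        48 * q ^ 2 * h ^ 2 * (∫ y, |H y| ^ p ∂(multivariateGaussian 0 S₀)) ^ (1 / p) := by
  set μ := multivariateGaussian 0 S₀ with hμ
  have hp1 : 1 < p := hpq.lt
  have hq1 : 1 < q := hpq.symm.lt
  have hq0 : 0 < q := by linarith
  have hqh : q * h ≤ 1 / 4 := by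
    rw [le_div_iff₀ (by positivity)] at hhq; linarith
  have hh4 : h ≤ 1 / 4 := by
    have : h ≤ q * h := by nlinarith
    linarith
  set B : Matrix ι ι ℝ := S₀⁻¹ - S₁⁻¹ with hBdef
  have hBt : Bᵀ = B := by
    rw [hBdef, Matrix.transpose_sub, Matrix.transpose_nonsing_inv, Matrix.transpose_nonsing_inv,
      Literature.Probability.Distributions.transpose_eq_of_posDef hS₀,
      Literature.Probability.Distributions.transpose_eq_of_posDef hS₁]
  set T : Matrix ι ι ℝ := CFC.sqrt S₀ * B * CFC.sqrt S₀ with hTdef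
  have htrT : (T * T).trace ≤ h ^ 2 := by rw [hTdef, trace_sqrt_sandwich_mul_self hS₀ B]; exact htr
  set Q : EuclideanSpace ℝ ι → ℝ := fun y => ofLp y ⬝ᵥ B *ᵥ ofLp y - T.trace with hQdef
  obtain ⟨c, hc, hreq⟩ := exists_gaussRatio_eq_exp_of_trace hS₀ hS₁ hh.le hh4 htr
  set Z : EuclideanSpace ℝ ι → ℝ := fun y => c + Q y / 2 with hZdef
  have hreq' : ∀ y, (gaussRatio S₀ S₁ y).toReal = Real.exp (Z y) := fun y => by
    rw [hreq y]
  -- continuity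
  have hcontQ : Continuous Q := by
    have hc' : Continuous fun x : EuclideanSpace ℝ ι => (ofLp x : ι → ℝ) := PiLp.continuous_ofLp 2 _
    exact (hc'.dotProduct (continuous_const.matrix_mulVec hc')).sub continuous_const
  have hcontZ : Continuous Z := continuous_const.add (hcontQ.div_const _)
  -- two-sided exponential moments of `Z`, the remainder `g = Z² e^{|Z|}` in `L^q`
  have hmgf : ∀ t : ℝ, 0 ≤ t → t * h ≤ 1 / 2 →
      Integrable (fun y => Real.exp (t * Z y) + Real.exp (-(t * Z y))) μ ∧
      ∫ y, (Real.exp (t * Z y) + Real.exp (-(t * Z y))) ∂μ ≤ 2 * Real.exp 1 :=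
    fun t ht hth => integral_exp_add_exp_logDensity_le hS₀ hBt hh.le hh4 htrT hc ht hth
  obtain ⟨hgint, hgbd⟩ :=
    integral_rpow_sq_mul_exp_abs_le (μ := μ) hcontZ.aestronglyMeasurable hh hq1 hqh hmgf
  set g : EuclideanSpace ℝ ι → ℝ := fun y => Z y ^ 2 * Real.exp |Z y| with hg
  have hg0 : ∀ y, 0 ≤ g y := fun y => by positivity
  have hgcont : Continuous g :=
    (hcontZ.pow 2).mul (Real.continuous_exp.comp (continuous_abs.comp hcontZ))
  -- `A = e^Z − 1 − Z`, `|A| ≤ g`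
  set A : EuclideanSpace ℝ ι → ℝ := fun y => (gaussRatio S₀ S₁ y).toReal - 1 - Z y with hA
  have hAg : ∀ y, |A y| ≤ g y := fun y => by
    simp only [hA, hg]; rw [hreq' y]
    exact Literature.Analysis.UnboundedOperators.abs_exp_sub_one_sub_le_sq_mul_exp_abs _
  have hqE : ENNReal.ofReal q ≠ 0 := by simp [hq0]
  have hgint' : Integrable (fun y => ‖g y‖ ^ q) μ :=
    hgint.congr (Filter.Eventually.of_forall fun y => by
      simp only [hg]; rw [Real.norm_of_nonneg (hg0 y)])
  have hgLq : MemLp g (ENNReal.ofReal q) μ := by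
    rw [← integrable_norm_rpow_iff hgcont.aestronglyMeasurable hqE ENNReal.ofReal_ne_top,
      ENNReal.toReal_ofReal hq0.le]
    exact hgint'
  have hAmeas : AEStronglyMeasurable A μ := by
    have : Continuous fun y => (gaussRatio S₀ S₁ y).toReal :=
      (Real.continuous_exp.comp hcontZ).congr fun y => (hreq' y).symm
    exact ((this.sub continuous_const).sub hcontZ).aestronglyMeasurable
  have hALq : MemLp A (ENNReal.ofReal q) μ :=
    hgLq.of_le hAmeas (Filter.Eventually.of_forall fun y => by
      rw [Real.norm_eq_abs, Real.norm_of_nonneg (hg0 y)]; exact hAg y)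
  -- Hölder pairings
  haveI : ENNReal.HolderConjugate (ENNReal.ofReal p) (ENNReal.ofReal q) :=
    ENNReal.holderConjugate_iff.2 hpq.inv_add_inv_ennreal
  have hAH : Integrable (fun y => A y * H y) μ := by
    have h1 := MemLp.mul' (f := H) (φ := A) (r := 1) hH hALq
    exact memLp_one_iff_integrable.1 h1
  obtain ⟨hQLq, -⟩ := memLp_quadForm_sub_trace_of_trace hS₀ hBt hh.le htrT hq1.le
  have hQH : Integrable (fun y => Q y * H y) μ := by
    have h1 := MemLp.mul' (f := H) (φ := Q) (r := 1) hH hQLq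
    exact memLp_one_iff_integrable.1 h1
  have hHint : Integrable H μ := hH.integrable (by
    rw [← ENNReal.ofReal_one]; exact ENNReal.ofReal_le_ofReal hp1.le)
  -- the identity `E_{S₁}H − E_{S₀}H − (cE_{S₀}H + ½E_{S₀}[QH]) = E_{S₀}[A H]`
  have hRH : (fun y => (gaussRatio S₀ S₁ y).toReal * H y) =
      fun y => A y * H y + (H y + (c * H y + 1 / 2 * (Q y * H y))) := by
    funext y; simp only [hA, hZdef]; ring
  have i3 : Integrable (fun y => c * H y + 1 / 2 * (Q y * H y)) μ :=
    (hHint.const_mul c).add (hQH.const_mul _)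
  have i2 : Integrable (fun y => H y + (c * H y + 1 / 2 * (Q y * H y))) μ := hHint.add i3
  have hdiff : ∫ y, H y ∂(multivariateGaussian 0 S₁) - ∫ y, H y ∂μ -
      (c * ∫ y, H y ∂μ + 1 / 2 * ∫ y, Q y * H y ∂μ) = ∫ y, A y * H y ∂μ := by
    rw [integral_multivariateGaussian_eq_integral_gaussRatio_mul hS₀ hS₁, hRH, ← hμ,
      integral_add hAH i2, integral_add hHint i3,
      integral_add (hHint.const_mul c) (hQH.const_mul _), integral_const_mul, integral_const_mul]
    ring
  refine ⟨c, hc, hQH, ?_⟩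
  rw [hdiff]
  -- `|E[AH]| ≤ ‖H‖_p ‖A‖_q ≤ 48 q² h² ‖H‖_p`
  have hholder := integral_mul_norm_le_Lp_mul_Lq hpq hH hALq
  have habs : |∫ y, A y * H y ∂μ| ≤ ∫ y, ‖H y‖ * ‖A y‖ ∂μ := by
    rw [← Real.norm_eq_abs]
    refine (norm_integral_le_integral_norm _).trans (le_of_eq ?_)
    refine integral_congr_ae (Filter.Eventually.of_forall fun y => ?_)
    simp only [norm_mul]; ring
  refine habs.trans (hholder.trans ?_)
  have hbase : 0 < 8 * h * q / Real.exp 1 := by positivity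
  have hAq_le : ∫ y, ‖A y‖ ^ q ∂μ ≤ (8 * h * q / Real.exp 1) ^ (2 * q) * (2 * Real.exp 1) := by
    calc ∫ y, ‖A y‖ ^ q ∂μ ≤ ∫ y, ‖g y‖ ^ q ∂μ := by
          refine integral_mono_of_nonneg (Filter.Eventually.of_forall fun y => by positivity) hgint'
            (Filter.Eventually.of_forall fun y => ?_)
          exact Real.rpow_le_rpow (norm_nonneg _)
            (by rw [Real.norm_eq_abs, Real.norm_of_nonneg (hg0 y)]; exact hAg y) hq0.le
      _ = ∫ y, (Z y ^ 2 * Real.exp |Z y|) ^ q ∂μ :=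
          integral_congr_ae (Filter.Eventually.of_forall fun y => by
            simp only [hg]; rw [Real.norm_of_nonneg (hg0 y)])
      _ ≤ _ := hgbd
  have he1 : 1 ≤ 2 * Real.exp 1 := by
    have := Real.add_one_le_exp (1 : ℝ); linarith
  have hroot : (∫ y, ‖A y‖ ^ q ∂μ) ^ (1 / q) ≤ 48 * q ^ 2 * h ^ 2 := by
    calc (∫ y, ‖A y‖ ^ q ∂μ) ^ (1 / q)
        ≤ ((8 * h * q / Real.exp 1) ^ (2 * q) * (2 * Real.exp 1)) ^ (1 / q) :=
          Real.rpow_le_rpow (integral_nonneg fun y => by positivity) hAq_le (by positivity)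
      _ = (8 * h * q / Real.exp 1) ^ (2 : ℝ) * (2 * Real.exp 1) ^ (1 / q) := by
          rw [Real.mul_rpow (Real.rpow_nonneg hbase.le _) (by positivity), ← Real.rpow_mul hbase.le,
            show 2 * q * (1 / q) = (2 : ℝ) by field_simp]
      _ ≤ (8 * h * q / Real.exp 1) ^ (2 : ℝ) * (2 * Real.exp 1) := by
          refine mul_le_mul_of_nonneg_left ?_ (Real.rpow_nonneg hbase.le _)
          calc (2 * Real.exp 1) ^ (1 / q) ≤ (2 * Real.exp 1) ^ (1 : ℝ) :=
                Real.rpow_le_rpow_of_exponent_le he1 (by rw [div_le_one hq0]; exact hq1.le)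
            _ = 2 * Real.exp 1 := Real.rpow_one _
      _ = 128 / Real.exp 1 * (q ^ 2 * h ^ 2) := by
          rw [Real.rpow_two]; field_simp; ring
      _ ≤ 48 * (q ^ 2 * h ^ 2) := by
          refine mul_le_mul_of_nonneg_right ?_ (by positivity)
          rw [div_le_iff₀ (Real.exp_pos 1)]
          have := Real.exp_one_gt_d9
          linarith
      _ = 48 * q ^ 2 * h ^ 2 := by ring
  have hHp0 : 0 ≤ (∫ y, ‖H y‖ ^ p ∂μ) ^ (1 / p) :=
    Real.rpow_nonneg (integral_nonneg fun y => by positivity) _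
  have hnormH : (∫ y, ‖H y‖ ^ p ∂μ) = ∫ y, |H y| ^ p ∂μ := by simp only [Real.norm_eq_abs]
  calc (∫ y, ‖H y‖ ^ p ∂μ) ^ (1 / p) * (∫ y, ‖A y‖ ^ q ∂μ) ^ (1 / q)
      ≤ (∫ y, ‖H y‖ ^ p ∂μ) ^ (1 / p) * (48 * q ^ 2 * h ^ 2) := mul_le_mul_of_nonneg_left hroot hHp0
    _ = 48 * q ^ 2 * h ^ 2 * (∫ y, |H y| ^ p ∂μ) ^ (1 / p) := by rw [hnormH]; ring

/-! ## The second-order comparison -/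

/-- `∫ |H| dN(0,S) ≤ (∫ |H|^p dN(0,S))^{1/p}` for `H ∈ L^p` of a centred Gaussian (Hölder with `1`,
probability measure). [cite: Buchholz2016, Thm 4.5 (proof)] -/
theorem integral_abs_le_rpow_integral_abs_rpow {S : Matrix ι ι ℝ} {p q : ℝ} (hpq : p.HolderConjugate q)
    {H : EuclideanSpace ℝ ι → ℝ} (hH : MemLp H (ENNReal.ofReal p) (multivariateGaussian 0 S)) :
    ∫ y, |H y| ∂(multivariateGaussian 0 S) ≤
      (∫ y, |H y| ^ p ∂(multivariateGaussian 0 S)) ^ (1 / p) := by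
  have h := integral_mul_norm_le_Lp_mul_Lq (μ := multivariateGaussian 0 S) hpq hH
    (memLp_const (1 : ℝ))
  have hq0 : 0 < q := by linarith [hpq.symm.lt]
  simp only [norm_one, mul_one, Real.one_rpow, integral_const, smul_eq_mul, probReal_univ,
    Real.norm_eq_abs] at h
  exact h

/-- **Dimension-free SECOND-ORDER comparison of centred Gaussians, real functionals** ([Buc16] Thm 4.5
with `ℓ = 2` / [ABKM19] Thm 6.2, integrated second-difference form).  Let `S₀, S₁, S₂ ≻ 0`,
`B_i = S₀⁻¹ − S_i⁻¹`, with `tr((S₀B₁)²) ≤ h²`, `tr((S₀B₂)²) ≤ h²` (`0 ≤ h ≤ 1/(4q)`) and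
`tr((S₀(B₁ + B₂))²) ≤ k²` (`k ≥ 0`); `p, q` Hölder conjugate; `H ∈ L^p(N(0,S₀))`.  Then
`|∫H dN(0,S₁) + ∫H dN(0,S₂) − 2∫H dN(0,S₀)| ≤ (100 q² h² + 4 q k) · (∫ |H|^p dN(0,S₀))^{1/p}`.
(The `h²`-terms: the two second-order remainders `e^{Z_i} − 1 − Z_i` and the constants `c₁ + c₂`; the
`k`-term: the centred chaos of `B₁ + B₂`, which carries the second difference of the precisions.  At the
midpoint of a covariance segment `k = O(h²)`, so the whole bound is quadratic in the step.)
[cite: Buchholz2016, Thm 4.5] -/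
theorem abs_integral_multivariateGaussian_secondDiff_le_of_trace {S₀ S₁ S₂ : Matrix ι ι ℝ}
    (hS₀ : S₀.PosDef) (hS₁ : S₁.PosDef) (hS₂ : S₂.PosDef) {h k : ℝ} (hh0 : 0 ≤ h) (hk0 : 0 ≤ k)
    (htr₁ : ((S₀ * (S₀⁻¹ - S₁⁻¹)) * (S₀ * (S₀⁻¹ - S₁⁻¹))).trace ≤ h ^ 2)
    (htr₂ : ((S₀ * (S₀⁻¹ - S₂⁻¹)) * (S₀ * (S₀⁻¹ - S₂⁻¹))).trace ≤ h ^ 2)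
    (htr₁₂ : ((S₀ * (S₀⁻¹ - S₁⁻¹ + (S₀⁻¹ - S₂⁻¹))) *
      (S₀ * (S₀⁻¹ - S₁⁻¹ + (S₀⁻¹ - S₂⁻¹)))).trace ≤ k ^ 2)
    {p q : ℝ} (hpq : p.HolderConjugate q) (hhq : h ≤ 1 / (4 * q))
    {H : EuclideanSpace ℝ ι → ℝ} (hH : MemLp H (ENNReal.ofReal p) (multivariateGaussian 0 S₀)) :
    |∫ y, H y ∂(multivariateGaussian 0 S₁) + ∫ y, H y ∂(multivariateGaussian 0 S₂) -
        2 * ∫ y, H y ∂(multivariateGaussian 0 S₀)| ≤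
      (100 * q ^ 2 * h ^ 2 + 4 * q * k) * (∫ y, |H y| ^ p ∂(multivariateGaussian 0 S₀)) ^ (1 / p) := by
  set μ := multivariateGaussian 0 S₀ with hμ
  have hp1 : 1 < p := hpq.lt
  have hq1 : 1 < q := hpq.symm.lt
  have hq0 : 0 < q := by linarith
  set Np : ℝ := (∫ y, |H y| ^ p ∂μ) ^ (1 / p) with hNp
  have hNp0 : 0 ≤ Np := Real.rpow_nonneg (integral_nonneg fun y => by positivity) _
  have hRHS0 : 0 ≤ (100 * q ^ 2 * h ^ 2 + 4 * q * k) * Np := by positivity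
  rcases hh0.eq_or_lt with h0 | hpos
  · -- `h = 0`: the three covariances coincide
    have h1 : S₁ = S₀ := eq_of_trace_mul_inv_sub_sq_le_zero hS₀ hS₁ (by
      have := htr₁; rw [← h0] at this; simpa using this)
    have h2 : S₂ = S₀ := eq_of_trace_mul_inv_sub_sq_le_zero hS₀ hS₂ (by
      have := htr₂; rw [← h0] at this; simpa using this)
    rw [h1, h2, ← hμ, show ∫ y, H y ∂μ + ∫ y, H y ∂μ - 2 * ∫ y, H y ∂μ = 0 by ring, abs_zero]
    exact hRHS0
  -- the two second-order expansions
  obtain ⟨c₁, hc₁, hQ₁H, hA₁⟩ := abs_integral_gaussRatio_sub_sub_linear_le hS₀ hS₁ hpos htr₁ hpq hhq hH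
  obtain ⟨c₂, hc₂, hQ₂H, hA₂⟩ := abs_integral_gaussRatio_sub_sub_linear_le hS₀ hS₂ hpos htr₂ hpq hhq hH
  set B₁ : Matrix ι ι ℝ := S₀⁻¹ - S₁⁻¹ with hB₁def
  set B₂ : Matrix ι ι ℝ := S₀⁻¹ - S₂⁻¹ with hB₂def
  have hB₁t : B₁ᵀ = B₁ := by
    rw [hB₁def, Matrix.transpose_sub, Matrix.transpose_nonsing_inv, Matrix.transpose_nonsing_inv,
      Literature.Probability.Distributions.transpose_eq_of_posDef hS₀,
      Literature.Probability.Distributions.transpose_eq_of_posDef hS₁]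
  have hB₂t : B₂ᵀ = B₂ := by
    rw [hB₂def, Matrix.transpose_sub, Matrix.transpose_nonsing_inv, Matrix.transpose_nonsing_inv,
      Literature.Probability.Distributions.transpose_eq_of_posDef hS₀,
      Literature.Probability.Distributions.transpose_eq_of_posDef hS₂]
  have hBt : (B₁ + B₂)ᵀ = B₁ + B₂ := by rw [Matrix.transpose_add, hB₁t, hB₂t]
  set T₁ : Matrix ι ι ℝ := CFC.sqrt S₀ * B₁ * CFC.sqrt S₀ with hT₁def
  set T₂ : Matrix ι ι ℝ := CFC.sqrt S₀ * B₂ * CFC.sqrt S₀ with hT₂def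
  have hT12 : CFC.sqrt S₀ * (B₁ + B₂) * CFC.sqrt S₀ = T₁ + T₂ := by
    simp only [hT₁def, hT₂def, Matrix.mul_add, Matrix.add_mul]
  have htrT : ((CFC.sqrt S₀ * (B₁ + B₂) * CFC.sqrt S₀) * (CFC.sqrt S₀ * (B₁ + B₂) * CFC.sqrt S₀)).trace
      ≤ k ^ 2 := by
    rw [trace_sqrt_sandwich_mul_self hS₀ (B₁ + B₂)]; exact htr₁₂
  obtain ⟨hQLq, hQbd⟩ := memLp_quadForm_sub_trace_of_trace hS₀ hBt hk0 htrT hq1.le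
  set Q : EuclideanSpace ℝ ι → ℝ := fun y => ofLp y ⬝ᵥ (B₁ + B₂) *ᵥ ofLp y -
    (CFC.sqrt S₀ * (B₁ + B₂) * CFC.sqrt S₀).trace with hQdef
  have hQsum : ∀ y : EuclideanSpace ℝ ι, Q y =
      (ofLp y ⬝ᵥ B₁ *ᵥ ofLp y - T₁.trace) + (ofLp y ⬝ᵥ B₂ *ᵥ ofLp y - T₂.trace) := fun y => by
    simp only [hQdef]
    rw [hT12, Matrix.trace_add, Matrix.add_mulVec, dotProduct_add]; ring
  haveI : ENNReal.HolderConjugate (ENNReal.ofReal p) (ENNReal.ofReal q) :=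
    ENNReal.holderConjugate_iff.2 hpq.inv_add_inv_ennreal
  have hQH : Integrable (fun y => Q y * H y) μ := by
    have h1 := MemLp.mul' (f := H) (φ := Q) (r := 1) hH hQLq
    exact memLp_one_iff_integrable.1 h1
  have hintsum : ∫ y, (ofLp y ⬝ᵥ B₁ *ᵥ ofLp y - T₁.trace) * H y ∂μ +
      ∫ y, (ofLp y ⬝ᵥ B₂ *ᵥ ofLp y - T₂.trace) * H y ∂μ = ∫ y, Q y * H y ∂μ := by
    rw [← integral_add hQ₁H hQ₂H]
    refine integral_congr_ae (Filter.Eventually.of_forall fun y => ?_)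
    simp only [hQsum]; ring
  -- `|E_{S₀}[QH]| ≤ 8 q k ‖H‖_p`, `|E_{S₀}H| ≤ ‖H‖_p`
  have hHp0 : 0 ≤ (∫ y, ‖H y‖ ^ p ∂μ) ^ (1 / p) :=
    Real.rpow_nonneg (integral_nonneg fun y => by positivity) _
  have hnormH : (∫ y, ‖H y‖ ^ p ∂μ) ^ (1 / p) = Np := by simp only [hNp, Real.norm_eq_abs]
  have hQHbd : |∫ y, Q y * H y ∂μ| ≤ 8 * q * k * Np := by
    have hholder := integral_mul_norm_le_Lp_mul_Lq hpq hH hQLq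
    have habs : |∫ y, Q y * H y ∂μ| ≤ ∫ y, ‖H y‖ * ‖Q y‖ ∂μ := by
      rw [← Real.norm_eq_abs]
      refine (norm_integral_le_integral_norm _).trans (le_of_eq ?_)
      refine integral_congr_ae (Filter.Eventually.of_forall fun y => ?_)
      simp only [norm_mul]; ring
    refine habs.trans (hholder.trans ?_)
    have hQn : (∫ y, ‖Q y‖ ^ q ∂μ) ^ (1 / q) ≤ 8 * q * k := by
      have : (∫ y, ‖Q y‖ ^ q ∂μ) = ∫ y, |Q y| ^ q ∂μ := by simp only [Real.norm_eq_abs]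
      rw [this]; exact hQbd
    calc (∫ y, ‖H y‖ ^ p ∂μ) ^ (1 / p) * (∫ y, ‖Q y‖ ^ q ∂μ) ^ (1 / q)
        ≤ (∫ y, ‖H y‖ ^ p ∂μ) ^ (1 / p) * (8 * q * k) := mul_le_mul_of_nonneg_left hQn hHp0
      _ = 8 * q * k * Np := by rw [hnormH]; ring
  have hE₀ : |∫ y, H y ∂μ| ≤ Np :=
    (abs_integral_le_integral_abs (f := H)).trans (integral_abs_le_rpow_integral_abs_rpow hpq hH)
  -- assemble
  have key : ∫ y, H y ∂(multivariateGaussian 0 S₁) + ∫ y, H y ∂(multivariateGaussian 0 S₂) -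
      2 * ∫ y, H y ∂μ =
      (∫ y, H y ∂(multivariateGaussian 0 S₁) - ∫ y, H y ∂μ -
          (c₁ * ∫ y, H y ∂μ + 1 / 2 * ∫ y, (ofLp y ⬝ᵥ B₁ *ᵥ ofLp y - T₁.trace) * H y ∂μ)) +
        (∫ y, H y ∂(multivariateGaussian 0 S₂) - ∫ y, H y ∂μ -
          (c₂ * ∫ y, H y ∂μ + 1 / 2 * ∫ y, (ofLp y ⬝ᵥ B₂ *ᵥ ofLp y - T₂.trace) * H y ∂μ)) +
        ((c₁ + c₂) * ∫ y, H y ∂μ + 1 / 2 * ∫ y, Q y * H y ∂μ) := by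
    rw [← hintsum]; ring
  rw [key]
  have hthird : |(c₁ + c₂) * ∫ y, H y ∂μ + 1 / 2 * ∫ y, Q y * H y ∂μ| ≤
      2 * h ^ 2 * Np + 4 * q * k * Np := by
    calc |(c₁ + c₂) * ∫ y, H y ∂μ + 1 / 2 * ∫ y, Q y * H y ∂μ|
        ≤ |(c₁ + c₂) * ∫ y, H y ∂μ| + |1 / 2 * ∫ y, Q y * H y ∂μ| := abs_add_le _ _
      _ = |c₁ + c₂| * |∫ y, H y ∂μ| + 1 / 2 * |∫ y, Q y * H y ∂μ| := by
          rw [abs_mul, abs_mul, abs_of_nonneg (by norm_num : (0:ℝ) ≤ 1 / 2)]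
      _ ≤ (2 * h ^ 2) * Np + 1 / 2 * (8 * q * k * Np) := by
          gcongr
          exact (abs_add_le _ _).trans (by linarith)
      _ = 2 * h ^ 2 * Np + 4 * q * k * Np := by ring
  have hh2 : 2 * h ^ 2 * Np ≤ 4 * q ^ 2 * h ^ 2 * Np := by
    have hq2 : 1 ≤ q ^ 2 := by nlinarith
    have : 0 ≤ h ^ 2 * Np := by positivity
    nlinarith
  calc |(∫ y, H y ∂(multivariateGaussian 0 S₁) - ∫ y, H y ∂μ -
          (c₁ * ∫ y, H y ∂μ + 1 / 2 * ∫ y, (ofLp y ⬝ᵥ B₁ *ᵥ ofLp y - T₁.trace) * H y ∂μ)) +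
        (∫ y, H y ∂(multivariateGaussian 0 S₂) - ∫ y, H y ∂μ -
          (c₂ * ∫ y, H y ∂μ + 1 / 2 * ∫ y, (ofLp y ⬝ᵥ B₂ *ᵥ ofLp y - T₂.trace) * H y ∂μ)) +
        ((c₁ + c₂) * ∫ y, H y ∂μ + 1 / 2 * ∫ y, Q y * H y ∂μ)|
      ≤ |∫ y, H y ∂(multivariateGaussian 0 S₁) - ∫ y, H y ∂μ -
          (c₁ * ∫ y, H y ∂μ + 1 / 2 * ∫ y, (ofLp y ⬝ᵥ B₁ *ᵥ ofLp y - T₁.trace) * H y ∂μ)| +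
        |∫ y, H y ∂(multivariateGaussian 0 S₂) - ∫ y, H y ∂μ -
          (c₂ * ∫ y, H y ∂μ + 1 / 2 * ∫ y, (ofLp y ⬝ᵥ B₂ *ᵥ ofLp y - T₂.trace) * H y ∂μ)| +
        |(c₁ + c₂) * ∫ y, H y ∂μ + 1 / 2 * ∫ y, Q y * H y ∂μ| := abs_add_three _ _ _
    _ ≤ 48 * q ^ 2 * h ^ 2 * Np + 48 * q ^ 2 * h ^ 2 * Np + (2 * h ^ 2 * Np + 4 * q * k * Np) :=
        add_le_add (add_le_add hA₁ hA₂) hthird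
    _ ≤ (100 * q ^ 2 * h ^ 2 + 4 * q * k) * Np := by nlinarith

/-- **Dimension-free SECOND-ORDER comparison of centred Gaussians, Banach-valued functionals** (the form
[ABKM19] Lemma 8.4 with `ℓ = 2` consumes, with the multilinear maps `D^s K(φ + ζ)`): under the hypotheses of
`abs_integral_multivariateGaussian_secondDiff_le_of_trace`, for `H ∈ L^p(N(0,S₀))` Banach-valued and
`N(0,S₁)`-, `N(0,S₂)`-integrable,
`‖∫H dN(0,S₁) + ∫H dN(0,S₂) − 2∫H dN(0,S₀)‖ ≤ (100 q² h² + 4 q k) · (∫ ‖H‖^p dN(0,S₀))^{1/p}`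
(duality: pair with `f` of norm `≤ 1` and apply the real estimate to `f ∘ H`). [cite: Buchholz2016, Thm 4.5] -/
theorem norm_integral_multivariateGaussian_secondDiff_le_of_trace {S₀ S₁ S₂ : Matrix ι ι ℝ}
    (hS₀ : S₀.PosDef) (hS₁ : S₁.PosDef) (hS₂ : S₂.PosDef) {h k : ℝ} (hh0 : 0 ≤ h) (hk0 : 0 ≤ k)
    (htr₁ : ((S₀ * (S₀⁻¹ - S₁⁻¹)) * (S₀ * (S₀⁻¹ - S₁⁻¹))).trace ≤ h ^ 2)
    (htr₂ : ((S₀ * (S₀⁻¹ - S₂⁻¹)) * (S₀ * (S₀⁻¹ - S₂⁻¹))).trace ≤ h ^ 2)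
    (htr₁₂ : ((S₀ * (S₀⁻¹ - S₁⁻¹ + (S₀⁻¹ - S₂⁻¹))) *
      (S₀ * (S₀⁻¹ - S₁⁻¹ + (S₀⁻¹ - S₂⁻¹)))).trace ≤ k ^ 2)
    {p q : ℝ} (hpq : p.HolderConjugate q) (hhq : h ≤ 1 / (4 * q))
    {F : Type*} [NormedAddCommGroup F] [NormedSpace ℝ F] [CompleteSpace F]
    {H : EuclideanSpace ℝ ι → F} (hH : MemLp H (ENNReal.ofReal p) (multivariateGaussian 0 S₀))
    (hH₁ : Integrable H (multivariateGaussian 0 S₁)) (hH₂ : Integrable H (multivariateGaussian 0 S₂)) :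
    ‖∫ y, H y ∂(multivariateGaussian 0 S₁) + ∫ y, H y ∂(multivariateGaussian 0 S₂) -
        (2 : ℝ) • ∫ y, H y ∂(multivariateGaussian 0 S₀)‖ ≤
      (100 * q ^ 2 * h ^ 2 + 4 * q * k) * (∫ y, ‖H y‖ ^ p ∂(multivariateGaussian 0 S₀)) ^ (1 / p) := by
  set μ := multivariateGaussian 0 S₀ with hμ
  have hp1 : 1 < p := hpq.lt
  have hp0 : 0 < p := by linarith
  have hq0 : 0 < q := by linarith [hpq.symm.lt]
  have hpE : ENNReal.ofReal p ≠ 0 := by simp [hp0]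
  have hHint : Integrable H μ := hH.integrable (by
    rw [← ENNReal.ofReal_one]; exact ENNReal.ofReal_le_ofReal hp1.le)
  have hnormp : Integrable (fun y => ‖H y‖ ^ p) μ := by
    have h := hH.integrable_norm_rpow hpE ENNReal.ofReal_ne_top
    rw [ENNReal.toReal_ofReal hp0.le] at h
    exact h
  have hC0 : 0 ≤ 100 * q ^ 2 * h ^ 2 + 4 * q * k := by positivity
  have hK0 : 0 ≤ (100 * q ^ 2 * h ^ 2 + 4 * q * k) * (∫ y, ‖H y‖ ^ p ∂μ) ^ (1 / p) :=
    mul_nonneg hC0 (Real.rpow_nonneg (integral_nonneg fun y => by positivity) _)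
  refine NormedSpace.norm_le_dual_bound ℝ _ hK0 fun f => ?_
  have hlin : f (∫ y, H y ∂(multivariateGaussian 0 S₁) + ∫ y, H y ∂(multivariateGaussian 0 S₂) -
      (2 : ℝ) • ∫ y, H y ∂μ) =
      ∫ y, f (H y) ∂(multivariateGaussian 0 S₁) + ∫ y, f (H y) ∂(multivariateGaussian 0 S₂) -
        2 * ∫ y, f (H y) ∂μ := by
    rw [map_sub, map_add, map_smul, ← ContinuousLinearMap.integral_comp_comm f hH₁,
      ← ContinuousLinearMap.integral_comp_comm f hH₂, ← ContinuousLinearMap.integral_comp_comm f hHint,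
      smul_eq_mul]
  rw [hlin]
  have hfH : MemLp (fun y => f (H y)) (ENNReal.ofReal p) μ := ContinuousLinearMap.comp_memLp' f hH
  have hreal := abs_integral_multivariateGaussian_secondDiff_le_of_trace hS₀ hS₁ hS₂ hh0 hk0 htr₁ htr₂
    htr₁₂ hpq hhq hfH
  rw [Real.norm_eq_abs]
  refine hreal.trans ?_
  have hroot := rpow_integral_abs_dual_apply_le (μ := μ) f hp0 hnormp
  calc (100 * q ^ 2 * h ^ 2 + 4 * q * k) * (∫ y, |f (H y)| ^ p ∂μ) ^ (1 / p)
      ≤ (100 * q ^ 2 * h ^ 2 + 4 * q * k) * (‖f‖ * (∫ y, ‖H y‖ ^ p ∂μ) ^ (1 / p)) :=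
        mul_le_mul_of_nonneg_left hroot hC0
    _ = (100 * q ^ 2 * h ^ 2 + 4 * q * k) * (∫ y, ‖H y‖ ^ p ∂μ) ^ (1 / p) * ‖f‖ := by ring

end Literature.MathematicalPhysics.QuantumFieldTheory

end
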